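/-
Copyright: the b2b-balaban T⁴-continuum CRUX team, row NE7b OWNER lineage `t4-ne7b-p1` (gen 134). Project licence.
-/
import Summits.QuantumFields.BalabanUV.T4Continuum.Spine.NE7b.SupBlockingLargeSets

/-!
# THE BLOCKED LEDGER — THE WHOLE OUTPUT IN THE INPUT'S NORM AT THE NEXT SCALE, WITH A CONSTANT: after the step ((356): weight `1+τ ↦ τ`) and the
# re-indexing by blocks ((360): large sets carry weight `a' := τℓ∕(m+1)` per block), the COMPLETE blocked norm at weight `a'` — small sets included —
# is controlled by the cell norm with a CONSTANT factor:
#   `Σ_{Y' ∋ p'}‖K'(Y')‖e^{a'#Y'} ≤ (e^{a'm} + 1)·b·e^{−τ}·η`,   `a' = τℓ∕(m+1)`,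
# (small block supports `#Y' ≤ m` pay at most `e^{a'm}` and have total mass `≤ b e^{−τ}η`; large ones are (360)).  So in polymer-norm bookkeeping the
# road's step followed by blocking maps «pinned norm `≤ η` at weight `1+τ` on cells» to «pinned norm `≤ C·η` at weight `a'` on blocks» with
# `C = (e^{a'm}+1)·b·e^{−τ}` INDEPENDENT OF THE VOLUME AND OF `η`: the class ITERATES WITH A CONSTANT FACTOR PER STEP once `a' ≥ 1 + τ`
# (i.e. `ℓ ≥ (m+1)(1+τ)∕τ`), and any CONTRACTION of `η` is analytic (the scaling of the activities — NC-NE7b-α proper), not combinatorial: the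
# honest end of SCOPING-d6's combinatorial column (row NE7b, node U5c; (360) BY NAME; [folklore])

Cell `pub-balaban`, sub-cell `t4`, spine estimate NE7b (`T4WeightBudget.RelWeightBound`; the cell's OWN estimate — NOT PRINTED in
[Bałaban 1983–89], NOT PROVED).  Crux-route work under `Spine/NE7b/` by the row OWNER (`t4-ne7b-p1` gen 134, file (367)) under FREEZE
(0)'s crux-prover clause, on `g134/records/SCOPING-d6-iteration.md` (L2)∕DECISION (4); NOTHING of Bałaban's is named as a Lean object, valued or
asserted; no `T4Continuum/Support` leaf typed; no `def`, no notation; zero `sorry`.  Imports (BY NAME): the OWNER's (360) `…SupBlockingLargeSets`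
(`blockedNorm_le_of_uniform_largeSet`, `largeSetNorm_le`); Mathlib's `Finset.sum_filter_add_sum_filter_not`.

WHAT IS PROVED ([folklore]; hypotheses of (360): `0 ≤ τ`, `q ∈ blk (B q)`, `#blk p' ≤ b`, separation `ℓ(#B(Y) − m) + 1 ≤ #Y` on `T`,
`sup_q Σ_{Y∈T, q∈Y}‖K(Y)‖e^{τ#Y} ≤ η`, `0 ≤ η`):
* `smallSetMass_le` (`Σ_{Y'∋p'}‖K'(Y')‖ ≤ b·e^{−τ}·η` — all block supports, weight zero), `smallSetNorm_le`
  (`Σ_{Y'∋p', #Y' ≤ m}‖K'(Y')‖e^{a'#Y'} ≤ e^{a'm}·b·e^{−τ}·η` for any `a' ≥ 0`), THE END **`blockedNorm_le`**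
  (`Σ_{Y'∋p'}‖K'(Y')‖e^{(τℓ∕(m+1))#Y'} ≤ (e^{(τℓ∕(m+1))m} + 1)·b·e^{−τ}·η`); toy.

HONEST (what this is NOT).  Combinatorics; the constant `C = (e^{a'm}+1)be^{−τ}` is NOT `< 1` in general — contraction of the norm across scales is the
analytic content of the renormalisation group (field rescaling, next-scale covariance, extraction of the relevant∕marginal local part), NC-NE7b-α proper,
untouched; scalar skeleton ((A3)); nothing of Bałaban's asserted.  BY-NAME EFFECT ON THE WALL: NONE.  NE7b NOT PRINTED ∕ NOT PROVED; spine PROVED 0∕9;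
rung (B)+1 — the programme's measures remain FINITE-torus statements; NOT the mass gap, NOT Clay.  HONEST DEPENDENCY: continuum YM on T⁴ ⇐ BetaPertH ∧
nine spine estimates (0∕9 proved); BetaPertH ⇐ (D1) ∧ (D4) ∧ CAP+tail; G-an2-4 gates asym, D1 and NE2∕3∕4.
-/

set_option autoImplicit false

noncomputable section

namespace Summit.QuantumFields.BalabanUV.T4Continuum.NE7b.SupBlockedNormLedger

open Finset Real
open scoped BigOperators
open Literature.Probability.LatticeModels
open SupBlockingLargeSets (blockedNorm_le_of_uniform_largeSet largeSetNorm_le)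

variable {V W : Type*} [DecidableEq V] [DecidableEq W] {K : Finset V → ℂ} {τ η : ℝ} {ℓ b m : ℕ}

/-- **THE TOTAL MASS OF THE BLOCKED TERMS THROUGH A BLOCK** (weight zero): `Σ_{Y'∋p'}‖K'(Y')‖ ≤ b·e^{−τ}·η` (drop (360)'s weights `e^{τℓ(#Y'−m)} ≥ 1`).
[folklore] -/
theorem smallSetMass_le (hτ : 0 ≤ τ) (B : V → W) (blk : W → Finset V) (hblk : ∀ q, q ∈ blk (B q)) (hb : ∀ p', (blk p').card ≤ b)
    (T : Finset (Finset V)) (hsep : ∀ Y ∈ T, ℓ * ((Y.image B).card - m) + 1 ≤ Y.card)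
    (hN : ∀ q : V, ∑ Y ∈ T with q ∈ Y, ‖K Y‖ * Real.exp (τ * (Y.card : ℝ)) ≤ η) (hη0 : 0 ≤ η) (p' : W) :
    ∑ Y' ∈ T.image (fun Y => Y.image B) with p' ∈ Y', ‖∑ Y ∈ T with Y.image B = Y', K Y‖ ≤ b * (Real.exp (-τ) * η) := by
  refine le_trans (sum_le_sum fun Y' _ => ?_) (blockedNorm_le_of_uniform_largeSet hτ B blk hblk hb T hsep hN hη0 p')
  exact le_mul_of_one_le_right (norm_nonneg _) (one_le_exp (by positivity))

/-- **THE SMALL SETS AT ANY WEIGHT**: `0 ≤ a'` ⟹ `Σ_{Y'∋p', #Y' ≤ m}‖K'(Y')‖e^{a'#Y'} ≤ e^{a'm}·b·e^{−τ}·η`. [folklore] -/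
theorem smallSetNorm_le (hτ : 0 ≤ τ) (B : V → W) (blk : W → Finset V) (hblk : ∀ q, q ∈ blk (B q)) (hb : ∀ p', (blk p').card ≤ b)
    (T : Finset (Finset V)) (hsep : ∀ Y ∈ T, ℓ * ((Y.image B).card - m) + 1 ≤ Y.card)
    (hN : ∀ q : V, ∑ Y ∈ T with q ∈ Y, ‖K Y‖ * Real.exp (τ * (Y.card : ℝ)) ≤ η) (hη0 : 0 ≤ η) {a' : ℝ} (ha' : 0 ≤ a') (p' : W) :
    ∑ Y' ∈ T.image (fun Y => Y.image B) with p' ∈ Y' ∧ Y'.card ≤ m,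
        ‖∑ Y ∈ T with Y.image B = Y', K Y‖ * Real.exp (a' * (Y'.card : ℝ)) ≤ Real.exp (a' * m) * (b * (Real.exp (-τ) * η)) := by
  calc ∑ Y' ∈ T.image (fun Y => Y.image B) with p' ∈ Y' ∧ Y'.card ≤ m, ‖∑ Y ∈ T with Y.image B = Y', K Y‖ * Real.exp (a' * (Y'.card : ℝ))
      ≤ ∑ Y' ∈ T.image (fun Y => Y.image B) with p' ∈ Y' ∧ Y'.card ≤ m, ‖∑ Y ∈ T with Y.image B = Y', K Y‖ * Real.exp (a' * m) := by
        refine sum_le_sum fun Y' hY' => mul_le_mul_of_nonneg_left (exp_le_exp.2 ?_) (norm_nonneg _)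
        have h := (mem_filter.1 hY').2.2
        exact mul_le_mul_of_nonneg_left (by exact_mod_cast h) ha'
    _ = Real.exp (a' * m) * ∑ Y' ∈ T.image (fun Y => Y.image B) with p' ∈ Y' ∧ Y'.card ≤ m, ‖∑ Y ∈ T with Y.image B = Y', K Y‖ := by
        rw [mul_sum]; exact sum_congr rfl fun _ _ => mul_comm _ _
    _ ≤ Real.exp (a' * m) * ∑ Y' ∈ T.image (fun Y => Y.image B) with p' ∈ Y', ‖∑ Y ∈ T with Y.image B = Y', K Y‖ := by
        refine mul_le_mul_of_nonneg_left (sum_le_sum_of_subset_of_nonneg (fun Y' hY' => ?_) fun _ _ _ => norm_nonneg _) (exp_pos _).le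
        exact mem_filter.2 ⟨(mem_filter.1 hY').1, (mem_filter.1 hY').2.1⟩
    _ ≤ Real.exp (a' * m) * (b * (Real.exp (-τ) * η)) :=
        mul_le_mul_of_nonneg_left (smallSetMass_le hτ B blk hblk hb T hsep hN hη0 p') (exp_pos _).le

/-- **THE END — THE BLOCKED LEDGER.**  Under the hypotheses of (360), with the next-scale weight `a' = τℓ∕(m+1)`:
`Σ_{Y'∋p'}‖K'(Y')‖e^{a'#Y'} ≤ (e^{a'm} + 1)·b·e^{−τ}·η` — the complete output, small and large block supports together, in the INPUT'S norm on blocks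
with a constant independent of the volume and of `η`. [folklore] -/
theorem blockedNorm_le (hτ : 0 ≤ τ) (B : V → W) (blk : W → Finset V) (hblk : ∀ q, q ∈ blk (B q)) (hb : ∀ p', (blk p').card ≤ b)
    (T : Finset (Finset V)) (hsep : ∀ Y ∈ T, ℓ * ((Y.image B).card - m) + 1 ≤ Y.card)
    (hN : ∀ q : V, ∑ Y ∈ T with q ∈ Y, ‖K Y‖ * Real.exp (τ * (Y.card : ℝ)) ≤ η) (hη0 : 0 ≤ η) (p' : W) :
    ∑ Y' ∈ T.image (fun Y => Y.image B) with p' ∈ Y',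
        ‖∑ Y ∈ T with Y.image B = Y', K Y‖ * Real.exp (τ * ℓ / (m + 1) * (Y'.card : ℝ)) ≤
      (Real.exp (τ * ℓ / (m + 1) * m) + 1) * (b * (Real.exp (-τ) * η)) := by
  have ha' : 0 ≤ τ * ℓ / (m + 1) := by positivity
  set S := (T.image (fun Y => Y.image B)).filter (fun Y' => p' ∈ Y') with hS
  set g : Finset W → ℝ := fun Y' => ‖∑ Y ∈ T with Y.image B = Y', K Y‖ * Real.exp (τ * ℓ / (m + 1) * (Y'.card : ℝ)) with hg
  -- split the block supports through `p'` into small (`#Y' ≤ m`) and large (`m + 1 ≤ #Y'`)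
  have hsplit := sum_filter_add_sum_filter_not S (fun Y' => Y'.card ≤ m) g
  have hsmall : ∑ Y' ∈ S with Y'.card ≤ m, g Y' ≤ Real.exp (τ * ℓ / (m + 1) * m) * (b * (Real.exp (-τ) * η)) := by
    have h := smallSetNorm_le (K := K) hτ B blk hblk hb T hsep hN hη0 ha' p'
    rw [hS, filter_filter]
    exact h
  have hlarge : ∑ Y' ∈ S with ¬ Y'.card ≤ m, g Y' ≤ b * (Real.exp (-τ) * η) := by
    have h := largeSetNorm_le (K := K) hτ B blk hblk hb T hsep hN hη0 p'
    rw [hS, filter_filter]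
    have hc : (T.image (fun Y => Y.image B)).filter (fun Y' => p' ∈ Y' ∧ ¬ Y'.card ≤ m) =
        (T.image (fun Y => Y.image B)).filter (fun Y' => p' ∈ Y' ∧ m + 1 ≤ Y'.card) :=
      filter_congr fun Y' _ => by constructor <;> rintro ⟨h1, h2⟩ <;> exact ⟨h1, by omega⟩
    rw [hc]
    exact h
  rw [← hsplit, add_mul, one_mul]
  exact add_le_add hsmall hlarge

/-! ## Toy -/

/-- Toy: with NO polymers (`T = ∅`) the blocked ledger reads `0 ≤ (e^{a'm}+1)·b·e^{−τ}·η`. -/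
example (hτ : 0 ≤ τ) (B : V → W) (blk : W → Finset V) (hblk : ∀ q, q ∈ blk (B q)) (hb : ∀ p', (blk p').card ≤ b) (hη0 : 0 ≤ η)
    (hN : ∀ q : V, ∑ Y ∈ (∅ : Finset (Finset V)) with q ∈ Y, ‖K Y‖ * Real.exp (τ * (Y.card : ℝ)) ≤ η) (p' : W) :
    ∑ Y' ∈ (∅ : Finset (Finset V)).image (fun Y => Y.image B) with p' ∈ Y',
        ‖∑ Y ∈ (∅ : Finset (Finset V)) with Y.image B = Y', K Y‖ * Real.exp (τ * ℓ / (m + 1) * (Y'.card : ℝ)) ≤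
      (Real.exp (τ * ℓ / (m + 1) * m) + 1) * (b * (Real.exp (-τ) * η)) :=
  blockedNorm_le hτ B blk hblk hb ∅ (fun _ h => absurd h (Finset.notMem_empty _)) hN hη0 p'

end Summit.QuantumFields.BalabanUV.T4Continuum.NE7b.SupBlockedNormLedger
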